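import Summits.BirchSwinnertonDyer.Rank1Residual.X11b.KummerRelaxedStructures
import Summits.BirchSwinnertonDyer.Rank1Residual.X11b.LevelLiftingLower
import Summits.BirchSwinnertonDyer.Rank1Residual.X11b.BDPRouteRelaxation
import Summits.BirchSwinnertonDyer.Rank1Residual.X11b.WeilTransport
import Summits.BirchSwinnertonDyer.Rank1Residual.X11b.PerfectPairingAnnihilators
import Literature.NumberTheory.EllipticCurves.LocalEulerCharacteristicTorsion
import HarnessLib

/-!
# X11b, routes R1/p2 — POITOU–TATE EXACTNESS FOR THE KUMMER STRUCTURE: `loc_S(H¹(G_S, E[p^k]))` is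
# the exact annihilator of itself in `⊕_{v∈S} H¹(K_v, E[p^k])` (Milne I Thm. 4.10(b), from the
# CITED Howard 2004 Thm. 2.1.11)

HONEST FRAMING (cell `b2b-bsdres`, run/shared/lean/b2b/bsd-rank1-residual/, verbatim in every
file): the goal of the cell is to DELETE the COMBINATION-SHAPED residual classes of the
Birch–Swinnerton-Dyer formula for ALL analytic-rank `≤ 1` elliptic curves over `ℚ` — "full BSD
formula for every rank `≤ 1` curve in class `C`" assembled STRICTLY from published theorems — so
that the rank-`≤ 1` remainder becomes exactly the CONSTRUCTION-SHAPED classes, which are TYPED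
(missing-input `Prop`s), NOT attempted. This is not "finishing BSD". Sub-cell
`b2b-bsdres-multr1-p1` (X11b, route R1 = Castella 2018 Thm. A re-proved along the author's
erratum); a RESEARCH ROUTE; no claim beyond the stated class; X11b stays CONSTRUCTION-SHAPED;
nothing here changes a label; no named fact is minted (theorems only; no `sorry`). CONDITIONAL on
the properties `IsPerfect`, `SumLocalTermEqZero`, `SelmerComplement` of a family of local invariant
maps (supplied by the cited fact `poitouTate_selmerStructure_duality K`, Howard 2004 Thm. 2.1.11 ⟸
Milne I Thm. 4.10(b)) and on Tate's local Euler characteristic count `#H¹(K_v, E[n]) = #𝓛_v²`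
(`localEulerPoincareCharacteristic K_v`, Milne I Thm. 2.8), taken as hypotheses.

## What is here (towards the EXACT base Selmer count = atom (P6) `BaseSelmerCountAt`, JSW17 Prop. 3.2.1 `=`)

Route p2's "Part B" (`BDPRouteRelaxation`) proved the `≤` half of the relaxation index
`[H¹_{𝓛, ⊤ at 𝔮}(K, E[n]) : Sel⁽ⁿ⁾(E/K)] ≤ [E(K_𝔮) : nE(K_𝔮) + im E(K)]` from the EASY half of
Poitou–Tate (the vanishing `∑_v ⟨x_v, y_v⟩_v = 0`).  The `≥` half needs the HARD half — existence of
global classes with prescribed local components — which in the tree is the cited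
`LocalInvariants.SelmerComplement`.  This file derives it in the Kummer vocabulary, for `E = W`
elliptic over a number field `K` all of whose infinite places are complex:

* §1 **the dual local condition of the Kummer condition is the Kummer condition** (through the
  Weil transport `w⁻¹ : E[n]^D ≅ E[n]` of `WeilTransport`): at a finite place `v` with `inv_v`
  injective and Tate's count, the RIGHT annihilator of `𝓛_v` under `inv_v(· ∪ₑ ·)` is `𝓛_v`
  (`annRight_invWeilPairing_kummer_eq`: Poonen–Rains isotropy + counting with
  `FiniteDuality.natCard_annRight_mul`; `invWeilPairing_flip_bijective` is local Tate duality, right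
  kernel), so `y_v ∈ 𝓛_v^* ⟹ H¹(w⁻¹_v) y_v ∈ 𝓛_v` (`map_weilDualInv_mem_kummer_of_mem_dualLocalCondition`,
  via `localTatePairingZMod_map_weilDual`); globally, a dual Selmer class for `(kummerStrict S')^*`
  has Weil transport in `kummerOutside W n S'` (`map_weilDualInv_mem_kummerOutside_of_mem_dualSelmerGroup`
  — "`H¹_{𝓕^*}(K, T^*) = H¹(G_{S'}, T)` for `T^* = T`"); and the isotropic half
  `sum_invWeilPairing_localization_eq_zero_of_mem_kummerOutside` (`∑_{v∈S'} inv_v(loc_v x ∪ₑ loc_v c) = 0`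
  for `x, c ∈ kummerOutside W n S'`).
* §2 **POITOU–TATE EXACTNESS FOR THE KUMMER STRUCTURE** (`exists_mem_kummerOutside_localization_eq`,
  level `p^k`): if `t ∈ ∏_{v∈S'} H¹(K_v, E[p^k])` satisfies `∑_{v∈S'} inv_v(t_v ∪ₑ loc_v c) = 0` for
  every `c ∈ kummerOutside W (p^k) S'`, then `t = loc_{S'} x` for some `x ∈ kummerOutside W (p^k) S'`.
  This is EXACTLY the hypothesis `hG` left open in the tree's Milne I Lemma 6.15 / 6.17 files
  (`CasselsTateLemma615(LocalInputs)`: "the image of `H¹(G_S, E[m])` in `X_S` is its own annihilator,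
  Poitou–Tate, Milne I Thm. 4.10(b)"), in the level-`n` Weil-cup-product currency of
  `BDPRouteRelaxation`.  Proof: `SelmerComplement` (i) for `kummerStrict S' ≤ kummerRelaxed S'`
  (`KummerRelaxedStructures`: unramified outside a finite `T ⊇ S' ∪ ∞ ∪ {v∣p} ∪ {bad}`), test family
  `t` extended by `0`; the obstruction against `y ∈ H¹_{(kummerStrict S')^*}` is
  `∑_{v∈S'} inv_v(t_v ∪ₑ loc_v ỹ)`, `ỹ = H¹(w⁻¹) y ∈ kummerOutside`, i.e. the hypothesis; the lift
  is exact on `S'` because `kummerStrict = ⊥` there.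

Consumer: `KummerRelaxationIndexExact` (`S' = {𝔮}`: `loc_𝔮(kummerOutside W n {𝔮})` self-annihilating,
the EXACT relaxation index `[kummerOutside W n {𝔮} : Sel⁽ⁿ⁾] · #loc_𝔮 Sel⁽ⁿ⁾ = #𝓛_𝔮`), whence the
exact count of Castella's `Sel_𝔭(K, E[p^∞])` (JSW17 Prop. 3.2.1 "`#im α = #coker β`") at `𝔮 = 𝔭̄`;
and the Cassels–Tate programme's `hG`.

References: [Howard2004HeegnerKolyvagin] Thm. 2.1.11 (arXiv:1202.6340 p. 6); [MilneADT2006] I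
Cor. 2.3, Thm. 2.8, Cor. 3.4, Thm. 4.10(b), Lemma 6.15, §6 proof of Prop. 6.9;
[JetchevSkinnerWan2017] Prop. 3.2.1, Prop. 3.3.2 (arXiv:1512.06894 pp. 10–11); [PoonenRains2012] Prop. 4.10.
-/

noncomputable section

open scoped Classical

open CategoryTheory Field NumberField IsDedekindDomain Function
open Literature.NumberTheory.EllipticCurves Literature.NumberTheory.EllipticCurves.GreenbergSelmer
open Literature.NumberTheory.GaloisRepresentations
open Literature.NumberTheory.GaloisRepresentations.DiscreteGaloisModule (SelmerStructure TateDual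
  tateDual localTatePairingZMod unramifiedSubgroup mu MuCarrier)
open Literature.NumberTheory.GaloisCohomology
open scoped ContRepresentation

namespace Summit.BirchSwinnertonDyer.Rank1Residual.X11b.KummerPT

open Summit.BirchSwinnertonDyer.Rank1Residual.X11b.LocBridge
open Summit.BirchSwinnertonDyer.Rank1Residual.X11b.Levels
open Summit.BirchSwinnertonDyer.Rank1Residual.X11b.AcSelmer
open Summit.BirchSwinnertonDyer.Rank1Residual.X11b.FiniteDuality
open Summit.BirchSwinnertonDyer.Rank1Residual.X11b.Relaxation

-- Cup products need `LocallyCompactSpace Γ`; finiteness of `E[p^k]`, `NeZero (p^k)`: local instances.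
attribute [local instance] absoluteGaloisGroup_compactSpace Levels.neZero_pow finite_geomTorsion_pow
  finite_geomTorsion_of_neZero Literature.NumberTheory.EllipticCurves.finite_muCarrier

variable {K : Type} [Field K] [NumberField K] (W : WeierstrassCurve K) [W.IsElliptic] (p k : ℕ)
  [Fact p.Prime]

/-! ## §1. The dual of the local Kummer condition, through the Weil transport, is the Kummer condition -/

section LocalDual

variable (n : ℕ) [NeZero n]
variable (e : W.geomTorsion n → W.geomTorsion n → AlgebraicClosure K)
  (hμ : ∀ S T, e S T ^ n = 1)
  (hadd₁ : ∀ S₁ S₂ T, e (S₁ + S₂) T = e S₁ T * e S₂ T)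
  (hadd₂ : ∀ S T₁ T₂, e S (T₁ + T₂) = e S T₁ * e S T₂)
  (hgal : ∀ (σ : absoluteGaloisGroup K) (S T : W.geomTorsion n), σ • e S T = e (σ • S) (σ • T))
  (halt : ∀ T, e T T = 1) (hnondeg : ∀ T, (∀ S, e S T = 1) → T = 0)
  (inv : LocalInvariants K n)

omit [W.IsElliptic] [NeZero n] in
/-- Every class of `H¹(K_v, E[n])` is killed by `n`. [folklore] -/
theorem nsmul_galoisCohomology_toLocal_eq_zero (v : Place K)
    (x : galoisCohomology ((W.torsionGaloisModule n).toLocal v) 1) : n • x = 0 :=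
  nsmul_continuousCohomology_one_eq_zero _ n (fun T : W.geomTorsion n ↦ AddSubgroup.torsionBy.nsmul T) x

/-- `H¹(K_v, E[n])` is finite at a finite place. [cite: MilneADT2006, Ch. I, Cor. 2.3 (finiteness)] -/
theorem finite_galoisCohomology_toLocal_inr (v : HeightOneSpectrum (𝓞 K)) :
    Finite (galoisCohomology ((W.torsionGaloisModule n).toLocal (Sum.inr v)) 1) := by
  haveI : CharZero (v.adicCompletion K) := charZero_adicCompletion v
  change Finite (galoisCohomology (GaloisRep.restrictField (v.adicCompletion K) (W.torsionGaloisModule n)) 1)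
  exact finite_galoisCohomology_one_of_isNonarchimedeanLocalField _

include hnondeg in
/-- **The right adjoint of `inv_v(· ∪ₑ ·)` on `H¹(K_v, E[n])` is bijective** when `inv_v` is injective
(local Tate duality for `E[n]`, right kernel — the tree's PROVED `eq_zero_of_forall_weilCupProduct_eq_zero_right_inr`
— plus counting `#Hom(A, ℤ/n) = #A`; companion of `Relaxation.invWeilPairing_bijective`).
[cite: MilneADT2006, Ch. I, Cor. 2.3] -/
theorem invWeilPairing_flip_bijective (v : HeightOneSpectrum (𝓞 K)) (hinv : Injective (inv (Sum.inr v))) :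
    Bijective (invWeilPairing W n e hμ hadd₁ hadd₂ hgal inv (Sum.inr v)).flip := by
  haveI := finite_galoisCohomology_toLocal_inr W n v
  have hA := nsmul_galoisCohomology_toLocal_eq_zero W n (Sum.inr v)
  haveI := finite_addMonoidHom_zmod (galoisCohomology ((W.torsionGaloisModule n).toLocal (Sum.inr v)) 1) n
  have hinj : Injective (invWeilPairing W n e hμ hadd₁ hadd₂ hgal inv (Sum.inr v)).flip := by
    intro y y' h
    rw [← sub_eq_zero]
    refine eq_zero_of_forall_weilCupProduct_eq_zero_right_inr W n e hμ hadd₁ hadd₂ v hgal hnondeg _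
      fun x ↦ ?_
    have h1 : invWeilPairing W n e hμ hadd₁ hadd₂ hgal inv (Sum.inr v) x (y - y') = 0 := by
      have h2 : invWeilPairing W n e hμ hadd₁ hadd₂ hgal inv (Sum.inr v) x y =
          invWeilPairing W n e hμ hadd₁ hadd₂ hgal inv (Sum.inr v) x y' := DFunLike.congr_fun h x
      rw [map_sub, h2, sub_self]
    rw [invWeilPairing_apply] at h1
    exact hinv (h1.trans (map_zero _).symm)
  exact hinj.bijective_of_nat_card_le (Nat.card_addMonoidHom_zmod hA).le

include halt hnondeg in
/-- **The right annihilator of the local Kummer condition under `inv_v(· ∪ₑ ·)` is the Kummer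
condition** at a finite place `v` with `inv_v` injective and Tate's count `#H¹(K_v, E[n]) = #𝓛_v²`:
`𝓛_v ≤ 𝓛_v^⊥` is the Poonen–Rains isotropy (`Relaxation.invWeilPairing_eq_zero_of_mem`) and
`#𝓛_v^⊥ · #𝓛_v = #H¹(K_v, E[n])` (`FiniteDuality.natCard_annRight_mul`).  Milne I Cor. 3.4 /
Lemma 6.15 (local input), right-handed. [cite: MilneADT2006, Ch. I, Cor. 3.4 and Lemma 6.15]
[cite: PoonenRains2012, Prop. 4.10] -/
theorem annRight_invWeilPairing_kummer_eq (v : HeightOneSpectrum (𝓞 K)) (hinv : Injective (inv (Sum.inr v)))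
    (hEuler : Nat.card (galoisCohomology ((W.torsionGaloisModule n).toLocal (Sum.inr v)) 1) =
      (Nat.card (nsmulAddMonoidHom n : (W.baseChange (v.adicCompletion K)).toAffine.Point →+ _).ker *
        Nat.card (v.adicCompletionIntegers K ⧸ Ideal.span {(n : v.adicCompletionIntegers K)})) ^ 2) :
    annRight (invWeilPairing W n e hμ hadd₁ hadd₂ hgal inv (Sum.inr v))
        (W.kummerSelmerStructure (n : ℤ) (Sum.inr v)) =
      W.kummerSelmerStructure (n : ℤ) (Sum.inr v) := by
  haveI := finite_galoisCohomology_toLocal_inr W n v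
  set b := invWeilPairing W n e hμ hadd₁ hadd₂ hgal inv (Sum.inr v) with hb
  set L := W.kummerSelmerStructure (n : ℤ) (Sum.inr v) with hL
  have hA := nsmul_galoisCohomology_toLocal_eq_zero W n (Sum.inr v)
  -- isotropy
  have hle : L ≤ annRight b L := fun y hy ↦ (mem_annRight_iff b L y).mpr fun x hx ↦
    invWeilPairing_eq_zero_of_mem W n e hμ hadd₁ hadd₂ hgal halt inv (Sum.inr v) hx hy
  -- counting
  have hmul : Nat.card (annRight b L) * Nat.card L =
      Nat.card (galoisCohomology ((W.torsionGaloisModule n).toLocal (Sum.inr v)) 1) :=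
    natCard_annRight_mul hA b (invWeilPairing_flip_bijective W n e hμ hadd₁ hadd₂ hgal hnondeg inv v hinv) L
  have hLcard : Nat.card L = Nat.card (nsmulAddMonoidHom n :
        (W.baseChange (v.adicCompletion K)).toAffine.Point →+ _).ker *
      Nat.card (v.adicCompletionIntegers K ⧸ Ideal.span {(n : v.adicCompletionIntegers K)}) :=
    W.natCard_kummerSelmerStructure_inr v (NeZero.ne n)
  have hLpos : 0 < Nat.card L := Nat.card_pos
  have hcard : Nat.card (annRight b L) = Nat.card L := by
    apply Nat.eq_of_mul_eq_mul_right hLpos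
    rw [hmul, hEuler, hLcard, sq]
  exact (AddSubgroup.eq_of_le_of_card_ge hle hcard.le).symm

include halt hnondeg in
/-- **The dual local condition of the Kummer condition, transported along `w⁻¹ : E[n]^D ≅ E[n]`,
lies in the Kummer condition**: at a finite place `v` with `inv_v` injective and Tate's Euler
characteristic count, if `y_v ∈ 𝓛_v^*` (Howard's dual local condition for the family `inv`, i.e.
`⟨a, y_v⟩_v = 0` for all `a ∈ 𝓛_v`) then `H¹(w⁻¹_v) y_v ∈ 𝓛_v` — because
`⟨a, H¹(w_v) ỹ⟩_v = inv_v(a ∪ₑ ỹ)` (`localTatePairingZMod_map_weilDual`) and `𝓛_v^⊥ = 𝓛_v`.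
[cite: MilneADT2006, Ch. I, Cor. 3.4 and §6 proof of Prop. 6.9] -/
theorem map_weilDualInv_mem_kummer_of_mem_dualLocalCondition (v : HeightOneSpectrum (𝓞 K))
    (hinv : Injective (inv (Sum.inr v)))
    (hEuler : Nat.card (galoisCohomology ((W.torsionGaloisModule n).toLocal (Sum.inr v)) 1) =
      (Nat.card (nsmulAddMonoidHom n : (W.baseChange (v.adicCompletion K)).toAffine.Point →+ _).ker *
        Nat.card (v.adicCompletionIntegers K ⧸ Ideal.span {(n : v.adicCompletionIntegers K)})) ^ 2)
    {yv : galoisCohomology (((W.torsionGaloisModule n).tateDual n).toLocal (Sum.inr v)) 1}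
    (hyv : yv ∈ inv.dualLocalCondition (W.torsionGaloisModule n) (Sum.inr v)
      (W.kummerSelmerStructure (n : ℤ) (Sum.inr v))) :
    galoisCohomology.map ((weilDualInv W n e hμ hadd₁ hadd₂ hgal hnondeg).restrictField
        (Place.Completion (Sum.inr v : Place K))) 1 yv ∈
      W.kummerSelmerStructure (n : ℤ) (Sum.inr v) := by
  set yW : galoisCohomology ((W.torsionGaloisModule n).toLocal (Sum.inr v)) 1 :=
    galoisCohomology.map ((weilDualInv W n e hμ hadd₁ hadd₂ hgal hnondeg).restrictField
      (Place.Completion (Sum.inr v : Place K))) 1 yv with hyWdef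
  have hw : galoisCohomology.map ((weilDualIntertwining W n e hμ hadd₁ hadd₂ hgal).restrictField
      (Place.Completion (Sum.inr v : Place K))) 1 yW = yv :=
    map_weilDual_map_weilDualInv_restrictField W n e hμ hadd₁ hadd₂ hgal hnondeg _ yv
  have key : yW ∈ annRight (invWeilPairing W n e hμ hadd₁ hadd₂ hgal inv (Sum.inr v))
      (W.kummerSelmerStructure (n : ℤ) (Sum.inr v)) := by
    rw [mem_annRight_iff]
    intro a ha
    rw [invWeilPairing_apply, ← localTatePairingZMod_map_weilDual W n e hμ hadd₁ hadd₂ hgal (Sum.inr v)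
      (inv (Sum.inr v)) a yW, hw]
    exact (inv.mem_dualLocalCondition_iff (W.torsionGaloisModule n) (Sum.inr v) _ yv).mp hyv a ha
  rw [annRight_invWeilPairing_kummer_eq W n e hμ hadd₁ hadd₂ hgal halt hnondeg inv v hinv hEuler] at key
  exact key

include halt in
/-- **The isotropic half (easy Poitou–Tate)**: for `x, c ∈ kummerOutside W n S'`,
`∑_{v∈S'} inv_v(loc_v x ∪ₑ loc_v c) = 0` — the Poitou–Tate vanishing `∑_v ⟨x_v, c_v⟩_v = 0`
(`SumLocalTermEqZero`, Milne I 4.10(b) `Im ⊆ Ker`) with the terms off `S'` killed by the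
Poonen–Rains isotropy of the local Kummer conditions. [cite: MilneADT2006, Ch. I, Thm. 4.10(b)]
[cite: PoonenRains2012, Prop. 4.10] -/
theorem sum_invWeilPairing_localization_eq_zero_of_mem_kummerOutside (hsum : inv.SumLocalTermEqZero)
    (S' : Finset (Place K)) {x c : galoisCohomology (W.torsionGaloisModule (n : ℤ)) 1}
    (hx : x ∈ kummerOutside W n S') (hc : c ∈ kummerOutside W n S') :
    ∑ v ∈ S', invWeilPairing W n e hμ hadd₁ hadd₂ hgal inv v
      (galoisCohomology.localization (W.torsionGaloisModule (n : ℤ)) v 1 x)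
      (galoisCohomology.localization (W.torsionGaloisModule (n : ℤ)) v 1 c) = 0 := by
  have hS : ∀ v ∉ S', inv v ((weilContPairingLocal W n e hμ hadd₁ hadd₂ hgal v).cupProduct
      (galoisCohomology.localization (W.torsionGaloisModule (n : ℤ)) v 1 x)
      (galoisCohomology.localization (W.torsionGaloisModule (n : ℤ)) v 1 c)) = 0 := by
    intro v hv
    have hxv : galoisCohomology.localization (W.torsionGaloisModule (n : ℤ)) v 1 x ∈
        W.kummerSelmerStructure (n : ℤ) v := (mem_kummerOutside_iff W n S' x).mp hx v hv
    have hcv : galoisCohomology.localization (W.torsionGaloisModule (n : ℤ)) v 1 c ∈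
        W.kummerSelmerStructure (n : ℤ) v := (mem_kummerOutside_iff W n S' c).mp hc v hv
    have h := invWeilPairing_eq_zero_of_mem W n e hμ hadd₁ hadd₂ hgal halt inv v hxv hcv
    rwa [invWeilPairing_apply] at h
  have h := sum_inv_weilCupProduct_localization_eq_zero W n e hμ hadd₁ hadd₂ hgal inv hsum x c S' hS
  simpa only [invWeilPairing_apply] using h

include halt hnondeg in
/-- **The Weil transport of a dual Selmer class for `(kummerStrict S')^*` lies in
`kummerOutside W n S'`** (all infinite places of `K` complex; `inv_v` injective and Tate's count at
the finite `v ∉ S'`): at a finite `v ∉ S'` the dual condition is `𝓛_v^*`, transported into `𝓛_v` by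
`map_weilDualInv_mem_kummer_of_mem_dualLocalCondition`; at a complex place every local class
vanishes. (This computes `H¹_{𝓕^*}(K, E[n]^D)` for `𝓕 = kummerStrict S'`: it is `kummerOutside W n S'`
up to the Weil transport — "`T^* = T`".) [cite: MilneADT2006, Ch. I §6, proof of Prop. 6.9]
[cite: JetchevSkinnerWan2017, Prop. 3.3.2 (arXiv:1512.06894 p. 11)] -/
theorem map_weilDualInv_mem_kummerOutside_of_mem_dualSelmerGroup
    (hK : ∀ w : InfinitePlace K, w.IsComplex) (S' : Finset (Place K))
    (hinv : ∀ v : HeightOneSpectrum (𝓞 K), (Sum.inr v : Place K) ∉ S' → Injective (inv (Sum.inr v)))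
    (hEuler : ∀ v : HeightOneSpectrum (𝓞 K), (Sum.inr v : Place K) ∉ S' →
      Nat.card (galoisCohomology ((W.torsionGaloisModule n).toLocal (Sum.inr v)) 1) =
        (Nat.card (nsmulAddMonoidHom n : (W.baseChange (v.adicCompletion K)).toAffine.Point →+ _).ker *
          Nat.card (v.adicCompletionIntegers K ⧸ Ideal.span {(n : v.adicCompletionIntegers K)})) ^ 2)
    {y : galoisCohomology ((W.torsionGaloisModule n).tateDual n) 1}
    (hy : y ∈ (inv.dualSelmerStructure (W.torsionGaloisModule n) (kummerStrict W n S')).selmerGroup) :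
    galoisCohomology.map (weilDualInv W n e hμ hadd₁ hadd₂ hgal hnondeg) 1 y ∈ kummerOutside W n S' := by
  set yW := galoisCohomology.map (weilDualInv W n e hμ hadd₁ hadd₂ hgal hnondeg) 1 y with hyWdef
  rw [mem_kummerOutside_iff]
  intro v hv
  have hyv := (SelmerStructure.mem_selmerGroup_iff _ y).mp hy v
  rw [LocalInvariants.dualSelmerStructure_apply, kummerStrict_of_not_mem W n S' hv] at hyv
  change galoisCohomology.localization (W.torsionGaloisModule (n : ℤ)) v 1 yW ∈
    W.kummerSelmerStructure (n : ℤ) v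
  cases v with
  | inl w =>
    rw [localization_inl_eq_zero_of_isComplex _ (hK w)]
    exact zero_mem _
  | inr v =>
    rw [hyWdef, localization_map_one]
    exact map_weilDualInv_mem_kummer_of_mem_dualLocalCondition W n e hμ hadd₁ hadd₂ hgal halt hnondeg
      inv v (hinv v hv) (hEuler v hv) hyv

end LocalDual

/-! ## §2. Poitou–Tate exactness for the Kummer structure -/

section Exactness

variable (e : W.geomTorsion ((p ^ k : ℕ) : ℤ) → W.geomTorsion ((p ^ k : ℕ) : ℤ) → AlgebraicClosure K)
  (hμ : ∀ S T, e S T ^ (p ^ k) = 1)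
  (hadd₁ : ∀ S₁ S₂ T, e (S₁ + S₂) T = e S₁ T * e S₂ T)
  (hadd₂ : ∀ S T₁ T₂, e S (T₁ + T₂) = e S T₁ * e S T₂)
  (hgal : ∀ (σ : absoluteGaloisGroup K) (S T : W.geomTorsion ((p ^ k : ℕ) : ℤ)),
    σ • e S T = e (σ • S) (σ • T))
  (halt : ∀ T, e T T = 1) (hnondeg : ∀ T, (∀ S, e S T = 1) → T = 0)

include halt hnondeg in
/-- **POITOU–TATE EXACTNESS FOR THE KUMMER STRUCTURE** (Milne I Thm. 4.10(b) `Ker γ¹ ⊆ Im β¹` at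
`⊕_{v∈S'} H¹(K_v, E[p^k])`, the hypothesis `hG` of the tree's Milne I Lemma 6.15/6.17 files — from the
CITED Howard Thm. 2.1.11 `SelmerComplement`).  Let `K` have all infinite places complex, `inv` a
Poitou–Tate family at level `p^k` with `IsPerfect` and `SelmerComplement`, and assume Tate's count
`#H¹(K_v, E[p^k]) = #𝓛_v²` at every finite place.  If a family of local classes
`t_v ∈ H¹(K_v, E[p^k])` (`v ∈ S'`) satisfies `∑_{v∈S'} inv_v(t_v ∪ₑ loc_v c) = 0` for every
`c ∈ kummerOutside W (p^k) S'`, then `t_v = loc_v x` on `S'` for some `x ∈ kummerOutside W (p^k) S'`.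
Proof: `SelmerComplement` (i) for `kummerStrict S' ≤ kummerRelaxed S'` (unramified outside a finite
`T ⊇ S' ∪ ∞ ∪ {v∣p} ∪ {bad}`), test family `t` extended by `0`; for `y ∈ H¹_{(kummerStrict S')^*}`,
`ỹ = H¹(w⁻¹) y ∈ kummerOutside W (p^k) S'` and `⟨t_v, loc_v y⟩_v = inv_v(t_v ∪ₑ loc_v ỹ)`, so the
obstruction is the hypothesis; the lift is exact on `S'` because `kummerStrict = ⊥` there.
[cite: Howard2004HeegnerKolyvagin, Thm. 2.1.11 (arXiv:1202.6340 p. 6)]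
[cite: MilneADT2006, Ch. I, Thm. 4.10(b) and Lemma 6.15] -/
theorem exists_mem_kummerOutside_localization_eq (hK : ∀ w : InfinitePlace K, w.IsComplex)
    {inv : LocalInvariants K (p ^ k)} (hperf : inv.IsPerfect) (hcompl : inv.SelmerComplement)
    (hEuler : ∀ v : HeightOneSpectrum (𝓞 K),
      Nat.card (galoisCohomology ((W.torsionGaloisModule ((p ^ k : ℕ) : ℤ)).toLocal (Sum.inr v)) 1) =
        (Nat.card (nsmulAddMonoidHom (p ^ k) :
            (W.baseChange (v.adicCompletion K)).toAffine.Point →+ _).ker *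
          Nat.card (v.adicCompletionIntegers K ⧸
            Ideal.span {((p ^ k : ℕ) : v.adicCompletionIntegers K)})) ^ 2)
    (S' : Finset (Place K))
    (t : Π v : Place K, galoisCohomology ((W.torsionGaloisModule ((p ^ k : ℕ) : ℤ)).toLocal v) 1)
    (ht : ∀ c ∈ kummerOutside W (p ^ k) S',
      ∑ v ∈ S', invWeilPairing W (p ^ k) e hμ hadd₁ hadd₂ hgal inv v (t v)
        (galoisCohomology.localization (W.torsionGaloisModule ((p ^ k : ℕ) : ℤ)) v 1 c) = 0) :
    ∃ x ∈ kummerOutside W (p ^ k) S', ∀ v ∈ S',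
      galoisCohomology.localization (W.torsionGaloisModule ((p ^ k : ℕ) : ℤ)) v 1 x = t v := by
  classical
  obtain ⟨T, hS'T, hinf, hp, hbad⟩ := exists_exceptional_finset W p S'
  have hMn : ∀ m : W.geomTorsion ((p ^ k : ℕ) : ℤ), (p ^ k) • m = 0 := fun m ↦
    AddSubgroup.torsionBy.nsmul m
  have hTout : ∀ v : HeightOneSpectrum (𝓞 K), (Sum.inr v : Place K) ∉ T →
      ((p ^ k : ℕ) : 𝓞 K) ∉ v.asIdeal ∧
        GaloisRep.IsUnramifiedAt v (W.torsionGaloisModule ((p ^ k : ℕ) : ℤ)) := by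
    intro v hv
    have hpv : ((p : ℕ) : 𝓞 K) ∉ v.asIdeal := fun h ↦ hv (hp v h)
    have hgood : W.HasGoodReductionAt v := by
      by_contra hbad'
      exact hv (hbad v hbad')
    exact ⟨natCast_pow_not_mem p hpv _,
      isUnramifiedAt_torsionGaloisModule W hgood (intCast_pow_not_mem p hpv _)⟩
  -- the test family, extended by zero off `S'`
  set t' : Π v : Place K, galoisCohomology ((W.torsionGaloisModule ((p ^ k : ℕ) : ℤ)).toLocal v) 1 :=
    fun v ↦ if v ∈ S' then t v else 0 with ht'def
  have ht'mem : ∀ v ∈ S', t' v = t v := fun v hv ↦ by rw [ht'def]; exact if_pos hv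
  have ht'not : ∀ v ∉ S', t' v = 0 := fun v hv ↦ by rw [ht'def]; exact if_neg hv
  have ht' : ∀ v ∈ T, t' v ∈ kummerRelaxed W (p ^ k) S' v := by
    intro v _
    by_cases hv : v ∈ S'
    · rw [kummerRelaxed_of_mem W (p ^ k) S' hv]; exact AddSubgroup.mem_top _
    · rw [ht'not v hv]; exact zero_mem _
  -- Poitou–Tate
  obtain ⟨x, hx, hxt⟩ := (hcompl (W.torsionGaloisModule ((p ^ k : ℕ) : ℤ)) hMn T hTout
    (kummerStrict W (p ^ k) S') (kummerRelaxed W (p ^ k) S') (kummerStrict_le_kummerRelaxed W (p ^ k) S')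
    (kummerStrict_isUnramifiedOutside W p k S' T hS'T hinf hp hbad)
    (kummerRelaxed_isUnramifiedOutside W p k S' T hS'T hinf hp hbad)).1 t' ht' (fun y hy ↦ by
      -- the obstruction vanishes
      set yW := galoisCohomology.map (weilDualInv W (p ^ k) e hμ hadd₁ hadd₂ hgal hnondeg) 1 y
        with hyWdef
      have hyW : galoisCohomology.map (weilDualIntertwining W (p ^ k) e hμ hadd₁ hadd₂ hgal) 1 yW = y :=
        map_weilDual_map_weilDualInv W (p ^ k) e hμ hadd₁ hadd₂ hgal hnondeg y
      have hyKO : yW ∈ kummerOutside W (p ^ k) S' :=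
        map_weilDualInv_mem_kummerOutside_of_mem_dualSelmerGroup W (p ^ k) e hμ hadd₁ hadd₂ hgal halt
          hnondeg inv hK S' (fun v _ ↦ (hperf v).1.1) (fun v _ ↦ hEuler v) hy
      have hterm : ∀ v : Place K,
          localTatePairingZMod (W.torsionGaloisModule ((p ^ k : ℕ) : ℤ)) (p ^ k) v (inv v) (t' v)
            (galoisCohomology.localization
              ((W.torsionGaloisModule ((p ^ k : ℕ) : ℤ)).tateDual (p ^ k)) v 1 y) =
          invWeilPairing W (p ^ k) e hμ hadd₁ hadd₂ hgal inv v (t' v)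
            (galoisCohomology.localization (W.torsionGaloisModule ((p ^ k : ℕ) : ℤ)) v 1 yW) := by
        intro v
        rw [← hyW, localization_map_one, localTatePairingZMod_map_weilDual, invWeilPairing_apply]
      calc ∑ v ∈ T, localTatePairingZMod (W.torsionGaloisModule ((p ^ k : ℕ) : ℤ)) (p ^ k) v (inv v)
              (t' v) (galoisCohomology.localization
                ((W.torsionGaloisModule ((p ^ k : ℕ) : ℤ)).tateDual (p ^ k)) v 1 y)
          = ∑ v ∈ T, invWeilPairing W (p ^ k) e hμ hadd₁ hadd₂ hgal inv v (t' v)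
              (galoisCohomology.localization (W.torsionGaloisModule ((p ^ k : ℕ) : ℤ)) v 1 yW) :=
            Finset.sum_congr rfl fun v _ ↦ hterm v
        _ = ∑ v ∈ S', invWeilPairing W (p ^ k) e hμ hadd₁ hadd₂ hgal inv v (t' v)
              (galoisCohomology.localization (W.torsionGaloisModule ((p ^ k : ℕ) : ℤ)) v 1 yW) := by
            refine (Finset.sum_subset hS'T fun v _ hvS' ↦ ?_).symm
            rw [ht'not v hvS', map_zero, AddMonoidHom.zero_apply]
        _ = ∑ v ∈ S', invWeilPairing W (p ^ k) e hμ hadd₁ hadd₂ hgal inv v (t v)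
              (galoisCohomology.localization (W.torsionGaloisModule ((p ^ k : ℕ) : ℤ)) v 1 yW) :=
            Finset.sum_congr rfl fun v hv ↦ by rw [ht'mem v hv]
        _ = 0 := ht yW hyKO)
  refine ⟨x, ?_, fun v hv ↦ ?_⟩
  · rw [← selmerGroup_kummerRelaxed W (p ^ k) S']
    exact hx
  · have h := hxt v (hS'T hv)
    rw [kummerStrict_of_mem W (p ^ k) S' hv, AddSubgroup.mem_bot, sub_eq_zero, ht'mem v hv] at h
    exact h

end Exactness

end Summit.BirchSwinnertonDyer.Rank1Residual.X11b.KummerPT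

end
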